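import Summits.AtomisticToContinuum.Crystallization.Theorems.FreeSplittingCertificatesStrictSplittingRuleTorusModel442CovB

/-!
# The joint (r6) sitewise LMI on the hcp torus 4×4×2 at EVERY site (Bravais covariance of the Lean model, checked in Lean)

Route `FreeSplittingCertificates`, crux `StrictSplittingRule` (stmt-AtomisticToContinuum-12560); unit b2b-freesplit-B (block 2b,
PART B, gen 1).  **VALUE = theorem about a FINITE model — NOT summit progress**; `stub_coreJointCoercive` is not proved.

`…TorusModel442A/B.lean` prove the torus LMI at the two reference sites `siteA = (0,0,0)`, `siteB = (1,0,0)`.  Every site of the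
torus is an even-layer translate of one of them and the model is translation covariant; this is CHECKED, not asserted:
`covA_check` / `covB_check` (`…TorusModel442CovA/CovB.lean`) verify by `native_decide` that for every even-layer shift `g` the term
lists (supply, transfers, κ-demand, readout form) generated at the shifted site are EXACTLY the reference lists with coordinates
relabelled by the translation; here `cover_check` (the shifts cover all 64 sites), `norm_perm_check` / `sumF_perm_check` (norm and
mean terms are permuted), and the transport:

`jointLMI442_allSites : ∀ (p : Site) (u : Fin 192 → ℚ), demand p u + margin442 · normSqG u ≤ supply p u + transfer p u + meanProj u`
(+ `jointLMI442_allSites_zeroMean`).  COMPUTATIONAL regime (`native_decide`, `Lean.ofReduceBool`). [folklore]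
-/

namespace Summit.AtomisticToContinuum.Crystallization.Theorems.StrictSplittingRuleTorusLMI

open Literature.Computation.Certificates

/-- Every site is an even-layer translate of the reference site of its parity.  COMPUTATIONAL (`native_decide`). -/
theorem cover_check : ∀ p : Site, ∃ g ∈ evenShifts, p = tadd (if parity p then siteA else siteB) g := by
  native_decide

/-- The norm terms are permuted by a translation.  COMPUTATIONAL (`native_decide`). -/
theorem norm_perm_check : ∀ g ∈ evenShifts, (normTerms.map (shiftTerm (shiftIdx g))).Perm normTerms := by
  native_decide

/-- The component-sum functionals are permuted by a translation.  COMPUTATIONAL (`native_decide`). -/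
theorem sumF_perm_check : ∀ g ∈ evenShifts, ∀ c : Fin 3, (LinF.relabel (shiftIdx g) (sumF c)).Perm (sumF c) := by
  native_decide

/-! ## Transport to every site -/

/-- `‖u ∘ σ_g‖²_G = ‖u‖²_G` for a translation. [folklore] -/
theorem normSqG_shift {g : Off} (hg : g ∈ evenShifts) (u : Fin 192 → ℚ) : normSqG (u ∘ shiftIdx g) = normSqG u := by
  unfold normSqG
  rw [← evalQ_mapShift, evalQ_perm (norm_perm_check g hg)]

/-- `meanProj (u ∘ σ_g) = meanProj u` for a translation. [folklore] -/
theorem meanProj_shift {g : Off} (hg : g ∈ evenShifts) (u : Fin 192 → ℚ) : meanProj (u ∘ shiftIdx g) = meanProj u := by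
  have h : ∀ c : Fin 3, LinF.eval (sumF c) (u ∘ shiftIdx g) = LinF.eval (sumF c) u := fun c => by
    rw [← LinF.eval_relabel, LinF.eval_perm (sumF_perm_check g hg c)]
  simp only [meanProj, projTerms, sq, evalQ_cons, evalQ_nil, h]

/-- The four forms at a translate are the reference forms at the translated field. [folklore] -/
theorem forms_shift {p r : Site} {g : Off}
    (hcov : siteTermLists p = (siteTermLists r).map fun ts => ts.map (shiftTerm (shiftIdx g))) (u : Fin 192 → ℚ) :
    supply p u = supply r (u ∘ shiftIdx g) ∧ transfer p u = transfer r (u ∘ shiftIdx g) ∧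
      demand p u = demand r (u ∘ shiftIdx g) := by
  simp only [siteTermLists, List.map_cons, List.map_nil, List.cons.injEq, and_true] at hcov
  obtain ⟨h1, h2, h3, h4⟩ := hcov
  refine ⟨?_, ?_, ?_⟩
  · unfold supply; rw [h1, evalQ_mapShift]
  · unfold transfer; rw [h2, evalQ_mapShift]
  · unfold demand; rw [h3, h4, evalQ_mapShift, evalQ_mapShift]

/-- **The joint (r6) sitewise LMI at EVERY site of the 4×4×2 hcp torus** (margin `m = 39101/2²⁰`): for every site `p` and every
displacement field `u`, `D_p(u) + m‖u‖²_G ≤ S_p(u) + T_p(u) + meanProj(u)`.  Finite model of H12⋆; not the stub. -/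
theorem jointLMI442_allSites (p : Site) (u : Fin 192 → ℚ) :
    demand p u + margin442 * normSqG u ≤ supply p u + transfer p u + meanProj u := by
  obtain ⟨g, hg, hp⟩ := cover_check p
  cases hpar : parity p
  · -- parity B
    rw [hpar] at hp; simp only [Bool.false_eq_true, ↓reduceIte] at hp
    have hcov := covB_check g hg
    rw [← hp] at hcov
    obtain ⟨hs, ht, hd⟩ := forms_shift hcov u
    have h := jointLMI442B (u ∘ shiftIdx g)
    rw [normSqG_shift hg, meanProj_shift hg, ← hs, ← ht, ← hd] at h
    exact h
  · -- parity A
    rw [hpar] at hp; simp only [↓reduceIte] at hp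
    have hcov := covA_check g hg
    rw [← hp] at hcov
    obtain ⟨hs, ht, hd⟩ := forms_shift hcov u
    have h := jointLMI442A (u ∘ shiftIdx g)
    rw [normSqG_shift hg, meanProj_shift hg, ← hs, ← ht, ← hd] at h
    exact h

/-- **Zero-mean form at every site.** -/
theorem jointLMI442_allSites_zeroMean (p : Site) (u : Fin 192 → ℚ) (h0 : ∀ c : Fin 3, (sumF c).eval u = 0) :
    demand p u + margin442 * normSqG u ≤ supply p u + transfer p u := by
  have h := jointLMI442_allSites p u
  rw [meanProj_eq_zero h0, add_zero] at h
  exact h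

end Summit.AtomisticToContinuum.Crystallization.Theorems.StrictSplittingRuleTorusLMI
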